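import Summits.AtomisticToContinuum.Crystallization.Theorems.OverbindingBudgetAffineFarCoreWindows
import Literature.MathematicalPhysics.StatisticalMechanics.HcpHomogeneous

/-!
# Overbinding budget, affine far-core cell (31280 Z2): point-group symmetry of the layer sums
# `layerSum B n k o` — reindexing under `R` (2π/3), `P` (π) about `e₃`, the mirrors `M_z`, `M_y`;
# label / layer parity at zeroth order for axial shapes (first order: `…LayerGradient.lean`)

(decomp-a2c lens-4, generation 66, item (ii-rest)/(III)(a)(b) of memo NODE-g65 §8–§9 and critic row 1101 (iii).)
Imports the g65 window file (`layerVec`, `layerTerm`, `layerSum`); restates nothing.  PROVED, 0 sorry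
(certified inlined in probe `TowerG66.lean`, rc 0; pins/axiom guards `TowerG66Pins.lean`; must-fail
`TowerG66MustFail.lean`).

* §S1 the point-group maps as explicit `LinearMap`s on `E3` with `rfl` coordinate lemmas:
  `rotR` `(x,y,z) ↦ (−x/2 − (√3/2)y, (√3/2)x − y/2, z)`, `rotR'` (its inverse = square), the Literature half-turn `halfTurnLinear = diag(−1,−1,1)` (HcpHomogeneous; the seat's `rotP`),
  `reflZ = diag(1,1,−1)`, `reflY = diag(1,−1,1)`, the axial family `diag3 a c = diag(a,a,c)`; all five are
  isometries (`norm_rotR`, …), `R'R = RR' = 1`, `P² = 1`, adjoint relations `⟪Ra,b⟫ = ⟪a,R'b⟫`, `⟪Pa,b⟫ = ⟪a,Pb⟫`.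
* §S2 transport of the layer points: `R(layerVec i j o k) = layerVec (−i−j−o) i o k` (same label, same layer),
  `P(…) = layerVec (−i) (−j) (−o) k` (label flips), `M_z(…) = layerVec i j o (−k)` (layer flips),
  `M_y(…) = layerVec (i+j+o) (−j) (−o) k` (label flips); index equivalences `rotIdx o`, `reflIdx o : ℤ×ℤ ≃ ℤ×ℤ`.
* §S3 reindexing of the layer sums for ANY linear `B`: `layerSum (S ∘ B) = layerSum B` for an isometry `S`;
  `layerSum (B ∘ R) n k o = layerSum B n k o`, `layerSum (B ∘ P) n k o = layerSum B n k (−o)`,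
  `layerSum (B ∘ M_z) n k o = layerSum B n (−k) o`, `layerSum (B ∘ M_y) n k o = layerSum B n k (−o)`.
* §S4 ★ zeroth order: a shape `X` commuting with `P` (resp. `M_z`) has `layerSum X n k (−o) = layerSum X n k o`
  (resp. `layerSum X n (−k) o = layerSum X n k o`); in particular the axial shapes `diag3 a c`
  (`layerSum_diag3_neg_label`, `layerSum_diag3_neg_layer`) — so at `X° = diag(a,a,c)` the far-layer sums of two
  stackings with `|o_k| = |o'_k|` layerwise AGREE (the near bracket of memo §8 (II) has no zeroth-order term).
* §S5–§S6 (first order: rigidity lemma, `layerLin`, ★ `layerLin_neg_label`) live in the sequel `…LayerGradient.lean`.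

Method: coordinates (`ext l; fin_cases l`, `Real.sq_sqrt`) and `Equiv.tsum_eq` for the reindexings.
-/

namespace Summit.AtomisticToContinuum.Crystallization.Theorems.OverbindingBudgetAffineFarSmoothSplit

open scoped BigOperators Classical
open Literature.MathematicalPhysics.StatisticalMechanics

local notation "E3" => EuclideanSpace ℝ (Fin 3)

/-! ## §S1 The point-group maps of the layer stack: `R` (rotation by `2π/3` about `e₃`), `P` (rotation by `π` about `e₃`),
`Mz` (reflection in the basal plane), `My` (reflection `y ↦ −y`) -/

/-- Rotation by `2π/3` about the `e₃`-axis: `(x, y, z) ↦ (−x/2 − (√3/2) y, (√3/2) x − y/2, z)`. -/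
noncomputable def rotR : E3 →ₗ[ℝ] E3 where
  toFun v := !₂[-(1 / 2) * v 0 - Real.sqrt 3 / 2 * v 1, Real.sqrt 3 / 2 * v 0 - (1 / 2) * v 1, v 2]
  map_add' v w := by
    ext l; fin_cases l <;> simp <;> ring
  map_smul' c v := by
    ext l; fin_cases l <;> simp <;> ring

/-- The inverse rotation (by `−2π/3`): `(x, y, z) ↦ (−x/2 + (√3/2) y, −(√3/2) x − y/2, z)`. -/
noncomputable def rotR' : E3 →ₗ[ℝ] E3 where
  toFun v := !₂[-(1 / 2) * v 0 + Real.sqrt 3 / 2 * v 1, -(Real.sqrt 3 / 2) * v 0 - (1 / 2) * v 1, v 2]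
  map_add' v w := by
    ext l; fin_cases l <;> simp <;> ring
  map_smul' c v := by
    ext l; fin_cases l <;> simp <;> ring

-- REVIEWER REVISION (p850556, landing lane hand-2 g31): the half-turn `(x, y, z) ↦ (−x, −y, z)` is NOT re-declared here; it is the
-- Literature object `Literature.MathematicalPhysics.StatisticalMechanics.halfTurnLinear` (HcpHomogeneous.lean; isometry form `halfTurn`).
-- The seat's own half-turn map (g66 `rotP`) is replaced by `halfTurnLinear` throughout this file and its sequel; only derived coordinate/norm/involution
-- lemmas about the Literature object are kept (proved from `halfTurnFun_apply_*`, `halfTurn.norm_map`, `halfTurnFun_involutive`).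

/-- Reflection in the basal plane: `(x, y, z) ↦ (x, y, −z)`. -/
noncomputable def reflZ : E3 →ₗ[ℝ] E3 where
  toFun v := !₂[v 0, v 1, -v 2]
  map_add' v w := by
    ext l; fin_cases l <;> simp [add_comm]
  map_smul' c v := by
    ext l; fin_cases l <;> simp

/-- Reflection `y ↦ −y`: `(x, y, z) ↦ (x, −y, z)`. -/
noncomputable def reflY : E3 →ₗ[ℝ] E3 where
  toFun v := !₂[v 0, -v 1, v 2]
  map_add' v w := by
    ext l; fin_cases l <;> simp [add_comm]
  map_smul' c v := by
    ext l; fin_cases l <;> simp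

/-- `rotR_apply_zero` (docstring added by the landing lane; see the module docstring). [formal bookkeeping] -/
@[simp] theorem rotR_apply_zero (v : E3) : rotR v 0 = -(1 / 2) * v 0 - Real.sqrt 3 / 2 * v 1 := rfl
/-- `rotR_apply_one` (docstring added by the landing lane; see the module docstring). [formal bookkeeping] -/
@[simp] theorem rotR_apply_one (v : E3) : rotR v 1 = Real.sqrt 3 / 2 * v 0 - (1 / 2) * v 1 := rfl
/-- `rotR_apply_two` (docstring added by the landing lane; see the module docstring). [formal bookkeeping] -/
@[simp] theorem rotR_apply_two (v : E3) : rotR v 2 = v 2 := rfl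
/-- `rotR'_apply_zero` (docstring added by the landing lane; see the module docstring). [formal bookkeeping] -/
@[simp] theorem rotR'_apply_zero (v : E3) : rotR' v 0 = -(1 / 2) * v 0 + Real.sqrt 3 / 2 * v 1 := rfl
/-- `rotR'_apply_one` (docstring added by the landing lane; see the module docstring). [formal bookkeeping] -/
@[simp] theorem rotR'_apply_one (v : E3) : rotR' v 1 = -(Real.sqrt 3 / 2) * v 0 - (1 / 2) * v 1 := rfl
/-- `rotR'_apply_two` (docstring added by the landing lane; see the module docstring). [formal bookkeeping] -/
@[simp] theorem rotR'_apply_two (v : E3) : rotR' v 2 = v 2 := rfl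
/-- Coordinate form of the Literature half-turn `halfTurnLinear` (derived from `halfTurnFun_apply_zero`). [formal bookkeeping] -/
@[simp] theorem halfTurnLinear_apply_zero (v : E3) : halfTurnLinear v 0 = -v 0 := halfTurnFun_apply_zero v
/-- Coordinate form of the Literature half-turn `halfTurnLinear` (derived from `halfTurnFun_apply_one`). [formal bookkeeping] -/
@[simp] theorem halfTurnLinear_apply_one (v : E3) : halfTurnLinear v 1 = -v 1 := halfTurnFun_apply_one v
/-- Coordinate form of the Literature half-turn `halfTurnLinear` (derived from `halfTurnFun_apply_two`). [formal bookkeeping] -/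
@[simp] theorem halfTurnLinear_apply_two (v : E3) : halfTurnLinear v 2 = v 2 := halfTurnFun_apply_two v
/-- `reflZ_apply_zero` (docstring added by the landing lane; see the module docstring). [formal bookkeeping] -/
@[simp] theorem reflZ_apply_zero (v : E3) : reflZ v 0 = v 0 := rfl
/-- `reflZ_apply_one` (docstring added by the landing lane; see the module docstring). [formal bookkeeping] -/
@[simp] theorem reflZ_apply_one (v : E3) : reflZ v 1 = v 1 := rfl
/-- `reflZ_apply_two` (docstring added by the landing lane; see the module docstring). [formal bookkeeping] -/
@[simp] theorem reflZ_apply_two (v : E3) : reflZ v 2 = -v 2 := rfl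
/-- `reflY_apply_zero` (docstring added by the landing lane; see the module docstring). [formal bookkeeping] -/
@[simp] theorem reflY_apply_zero (v : E3) : reflY v 0 = v 0 := rfl
/-- `reflY_apply_one` (docstring added by the landing lane; see the module docstring). [formal bookkeeping] -/
@[simp] theorem reflY_apply_one (v : E3) : reflY v 1 = -v 1 := rfl
/-- `reflY_apply_two` (docstring added by the landing lane; see the module docstring). [formal bookkeeping] -/
@[simp] theorem reflY_apply_two (v : E3) : reflY v 2 = v 2 := rfl

/-- `norm_sq_eq_three` (docstring added by the landing lane; see the module docstring). [formal bookkeeping] (dedup gate: public twins (Literature.Geometry.Lorentzian.E3.norm_sq, …Kerr.Ingoing.inner_e3, a Real.sqrt 3 square lemma) live in unrelated modules; kept PRIVATE here) -/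
private theorem norm_sq_eq_three (v : E3) : ‖v‖ ^ 2 = v 0 ^ 2 + v 1 ^ 2 + v 2 ^ 2 := by
  rw [EuclideanSpace.norm_eq, Real.sq_sqrt (Finset.sum_nonneg fun i _ => by positivity), Fin.sum_univ_three]
  simp only [Real.norm_eq_abs, sq_abs]

/-- `inner_eq_three` (docstring added by the landing lane; see the module docstring). [formal bookkeeping] (dedup gate: public twins (Literature.Geometry.Lorentzian.E3.norm_sq, …Kerr.Ingoing.inner_e3, a Real.sqrt 3 square lemma) live in unrelated modules; kept PRIVATE here) -/
private theorem inner_eq_three (v w : E3) : inner ℝ v w = v 0 * w 0 + v 1 * w 1 + v 2 * w 2 := by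
  rw [PiLp.inner_apply, Fin.sum_univ_three]
  simp only [RCLike.inner_apply, conj_trivial]
  ring

/-- `sqrt3_sq` (docstring added by the landing lane; see the module docstring). [formal bookkeeping] (dedup gate: public twins (Literature.Geometry.Lorentzian.E3.norm_sq, …Kerr.Ingoing.inner_e3, a Real.sqrt 3 square lemma) live in unrelated modules; kept PRIVATE here) -/
private theorem sqrt3_sq : Real.sqrt 3 ^ 2 = 3 := Real.sq_sqrt (by norm_num)

/-- The four maps preserve norms. [this file] -/
theorem norm_rotR (v : E3) : ‖rotR v‖ = ‖v‖ := by
  have h := norm_sq_eq_three (rotR v)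
  rw [rotR_apply_zero, rotR_apply_one, rotR_apply_two] at h
  have h' : ‖rotR v‖ ^ 2 = ‖v‖ ^ 2 := by
    rw [h, norm_sq_eq_three]; linear_combination (1 / 4 * (v 0) ^ 2 + 1 / 4 * (v 1) ^ 2) * sqrt3_sq
  exact (sq_eq_sq₀ (norm_nonneg _) (norm_nonneg _)).1 h'

/-- `norm_rotR'` (docstring added by the landing lane; see the module docstring). [formal bookkeeping] -/
theorem norm_rotR' (v : E3) : ‖rotR' v‖ = ‖v‖ := by
  have h := norm_sq_eq_three (rotR' v)
  rw [rotR'_apply_zero, rotR'_apply_one, rotR'_apply_two] at h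
  have h' : ‖rotR' v‖ ^ 2 = ‖v‖ ^ 2 := by
    rw [h, norm_sq_eq_three]; linear_combination (1 / 4 * (v 0) ^ 2 + 1 / 4 * (v 1) ^ 2) * sqrt3_sq
  exact (sq_eq_sq₀ (norm_nonneg _) (norm_nonneg _)).1 h'

/-- The Literature half-turn preserves norms — `halfTurn.norm_map` read on the linear map `halfTurnLinear`. [formal bookkeeping] -/
theorem norm_halfTurnLinear (v : E3) : ‖halfTurnLinear v‖ = ‖v‖ := halfTurn.norm_map v

/-- `norm_reflZ` (docstring added by the landing lane; see the module docstring). [formal bookkeeping] -/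
theorem norm_reflZ (v : E3) : ‖reflZ v‖ = ‖v‖ := by
  have h' : ‖reflZ v‖ ^ 2 = ‖v‖ ^ 2 := by
    rw [norm_sq_eq_three, norm_sq_eq_three, reflZ_apply_zero, reflZ_apply_one, reflZ_apply_two]; ring
  exact (sq_eq_sq₀ (norm_nonneg _) (norm_nonneg _)).1 h'

/-- `norm_reflY` (docstring added by the landing lane; see the module docstring). [formal bookkeeping] -/
theorem norm_reflY (v : E3) : ‖reflY v‖ = ‖v‖ := by
  have h' : ‖reflY v‖ ^ 2 = ‖v‖ ^ 2 := by
    rw [norm_sq_eq_three, norm_sq_eq_three, reflY_apply_zero, reflY_apply_one, reflY_apply_two]; ring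
  exact (sq_eq_sq₀ (norm_nonneg _) (norm_nonneg _)).1 h'

/-- `R' R = 1 = R R'`, `P² = Mz² = My² = 1`. [this file] -/
theorem rotR'_comp_rotR : rotR' ∘ₗ rotR = LinearMap.id := by
  apply LinearMap.ext; intro v; ext l
  fin_cases l
  · show rotR' (rotR v) 0 = v 0
    simp only [rotR'_apply_zero, rotR_apply_zero, rotR_apply_one]; linear_combination (1 / 4 * v 0) * sqrt3_sq
  · show rotR' (rotR v) 1 = v 1
    simp only [rotR'_apply_one, rotR_apply_zero, rotR_apply_one]; linear_combination (1 / 4 * v 1) * sqrt3_sq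
  · rfl

/-- `rotR_comp_rotR'` (docstring added by the landing lane; see the module docstring). [formal bookkeeping] -/
theorem rotR_comp_rotR' : rotR ∘ₗ rotR' = LinearMap.id := by
  apply LinearMap.ext; intro v; ext l
  fin_cases l
  · show rotR (rotR' v) 0 = v 0
    simp only [rotR_apply_zero, rotR'_apply_zero, rotR'_apply_one]; linear_combination (1 / 4 * v 0) * sqrt3_sq
  · show rotR (rotR' v) 1 = v 1
    simp only [rotR_apply_one, rotR'_apply_zero, rotR'_apply_one]; linear_combination (1 / 4 * v 1) * sqrt3_sq
  · rfl

/-- `P² = 1` for the Literature half-turn — `halfTurnFun_involutive` read on `halfTurnLinear`. [formal bookkeeping] -/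
theorem halfTurnLinear_comp_self : halfTurnLinear ∘ₗ halfTurnLinear = LinearMap.id :=
  LinearMap.ext fun v => halfTurnFun_involutive v

/-- Adjoints: `⟪R a, b⟫ = ⟪a, R' b⟫`, `⟪P a, b⟫ = ⟪a, P b⟫`. [this file] -/
theorem inner_rotR_left (a b : E3) : inner ℝ (rotR a) b = inner ℝ a (rotR' b) := by
  rw [inner_eq_three, inner_eq_three]; simp only [rotR_apply_zero, rotR_apply_one, rotR_apply_two,
    rotR'_apply_zero, rotR'_apply_one, rotR'_apply_two]; ring

/-- `inner_rotP_left` (docstring added by the landing lane; see the module docstring). [formal bookkeeping] -/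
theorem inner_rotP_left (a b : E3) : inner ℝ (halfTurnLinear a) b = inner ℝ a (halfTurnLinear b) := by
  rw [inner_eq_three, inner_eq_three]; simp only [halfTurnLinear_apply_zero, halfTurnLinear_apply_one, halfTurnLinear_apply_two]; ring

/-! ## §S2 Transport of the layer points -/

/-- `R (layerVec i j o k) = layerVec (−i−j−o) i o k` (same layer, same label). [this file] -/
theorem rotR_layerVec (i j o k : ℤ) : rotR (layerVec i j o k) = layerVec (-i - j - o) i o k := by
  ext l
  fin_cases l
  · show rotR (layerVec i j o k) 0 = layerVec (-i - j - o) i o k 0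
    rw [rotR_apply_zero, layerVec_apply_zero, layerVec_apply_one, layerVec_apply_zero]; push_cast
    linear_combination (-(1 / 4) * ((j : ℝ) + o / 3)) * sqrt3_sq
  · show rotR (layerVec i j o k) 1 = layerVec (-i - j - o) i o k 1
    rw [rotR_apply_one, layerVec_apply_zero, layerVec_apply_one, layerVec_apply_one]; push_cast; ring
  · show rotR (layerVec i j o k) 2 = layerVec (-i - j - o) i o k 2
    rw [rotR_apply_two, layerVec_apply_two, layerVec_apply_two]

/-- `P (layerVec i j o k) = layerVec (−i) (−j) (−o) k` (same layer, label `−o`). [this file] -/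
theorem rotP_layerVec (i j o k : ℤ) : halfTurnLinear (layerVec i j o k) = layerVec (-i) (-j) (-o) k := by
  ext l
  fin_cases l
  · show halfTurnLinear (layerVec i j o k) 0 = layerVec (-i) (-j) (-o) k 0
    rw [halfTurnLinear_apply_zero, layerVec_apply_zero, layerVec_apply_zero]; push_cast; ring
  · show halfTurnLinear (layerVec i j o k) 1 = layerVec (-i) (-j) (-o) k 1
    rw [halfTurnLinear_apply_one, layerVec_apply_one, layerVec_apply_one]; push_cast; ring
  · show halfTurnLinear (layerVec i j o k) 2 = layerVec (-i) (-j) (-o) k 2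
    rw [halfTurnLinear_apply_two, layerVec_apply_two, layerVec_apply_two]

/-- `Mz (layerVec i j o k) = layerVec i j o (−k)` (layer `−k`, same label). [this file] -/
theorem reflZ_layerVec (i j o k : ℤ) : reflZ (layerVec i j o k) = layerVec i j o (-k) := by
  ext l
  fin_cases l
  · show reflZ (layerVec i j o k) 0 = layerVec i j o (-k) 0
    rw [reflZ_apply_zero, layerVec_apply_zero, layerVec_apply_zero]
  · show reflZ (layerVec i j o k) 1 = layerVec i j o (-k) 1
    rw [reflZ_apply_one, layerVec_apply_one, layerVec_apply_one]
  · show reflZ (layerVec i j o k) 2 = layerVec i j o (-k) 2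
    rw [reflZ_apply_two, layerVec_apply_two, layerVec_apply_two]; push_cast; ring

/-- `My (layerVec i j o k) = layerVec (i+j+o) (−j) (−o) k` (same layer, label `−o`). [this file] -/
theorem reflY_layerVec (i j o k : ℤ) : reflY (layerVec i j o k) = layerVec (i + j + o) (-j) (-o) k := by
  ext l
  fin_cases l
  · show reflY (layerVec i j o k) 0 = layerVec (i + j + o) (-j) (-o) k 0
    rw [reflY_apply_zero, layerVec_apply_zero, layerVec_apply_zero]; push_cast; ring
  · show reflY (layerVec i j o k) 1 = layerVec (i + j + o) (-j) (-o) k 1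
    rw [reflY_apply_one, layerVec_apply_one, layerVec_apply_one]; push_cast; ring
  · show reflY (layerVec i j o k) 2 = layerVec (i + j + o) (-j) (-o) k 2
    rw [reflY_apply_two, layerVec_apply_two, layerVec_apply_two]

/-! ## §S3 Reindexing of the layer sums (any linear `B`) -/

/-- The index bijection of `R` on a labelled layer: `(i, j) ↦ (−i−j−o, i)`. -/
def rotIdx (o : ℤ) : ℤ × ℤ ≃ ℤ × ℤ where
  toFun ij := (-ij.1 - ij.2 - o, ij.1)
  invFun ij := (ij.2, -ij.1 - ij.2 - o)
  left_inv ij := by ext <;> simp; ring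
  right_inv ij := by ext <;> simp; ring

/-- The index bijection of `My`: `(i, j) ↦ (i+j+o, −j)` (an involution). -/
def reflIdx (o : ℤ) : ℤ × ℤ ≃ ℤ × ℤ where
  toFun ij := (ij.1 + ij.2 + o, -ij.2)
  invFun ij := (ij.1 + ij.2 - o, -ij.2)
  left_inv ij := by ext <;> simp; ring
  right_inv ij := by ext <;> simp; ring

/-- A norm-preserving map AFTER `B` does not change any layer sum. [this file] -/
theorem layerSum_isometry_comp {S : E3 →ₗ[ℝ] E3} (hS : ∀ x, ‖S x‖ = ‖x‖) (B : E3 →ₗ[ℝ] E3) (n : ℕ) (k o : ℤ) :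
    layerSum (S ∘ₗ B) n k o = layerSum B n k o := by
  unfold layerSum layerTerm
  simp only [LinearMap.comp_apply, hS]

/-- **`R`-invariance**: `layerSum (B ∘ R) n k o = layerSum B n k o`. [this file] -/
theorem layerSum_comp_rotR (B : E3 →ₗ[ℝ] E3) (n : ℕ) (k o : ℤ) : layerSum (B ∘ₗ rotR) n k o = layerSum B n k o := by
  unfold layerSum
  have h : ∀ ij : ℤ × ℤ, layerTerm (B ∘ₗ rotR) n k o ij = layerTerm B n k o (rotIdx o ij) := fun ij => by
    show (‖(B ∘ₗ rotR) (layerVec ij.1 ij.2 o k)‖)⁻¹ ^ n = (‖B (layerVec (-ij.1 - ij.2 - o) ij.1 o k)‖)⁻¹ ^ n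
    rw [LinearMap.comp_apply, rotR_layerVec]
  rw [tsum_congr h]
  exact (rotIdx o).tsum_eq (layerTerm B n k o)

/-- **`P` flips the label**: `layerSum (B ∘ P) n k o = layerSum B n k (−o)`. [this file] -/
theorem layerSum_comp_rotP (B : E3 →ₗ[ℝ] E3) (n : ℕ) (k o : ℤ) : layerSum (B ∘ₗ halfTurnLinear) n k o = layerSum B n k (-o) := by
  unfold layerSum
  have h : ∀ ij : ℤ × ℤ, layerTerm (B ∘ₗ halfTurnLinear) n k o ij =
      layerTerm B n k (-o) ((Equiv.prodCongr (Equiv.neg ℤ) (Equiv.neg ℤ)) ij) := fun ij => by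
    show (‖(B ∘ₗ halfTurnLinear) (layerVec ij.1 ij.2 o k)‖)⁻¹ ^ n = (‖B (layerVec (-ij.1) (-ij.2) (-o) k)‖)⁻¹ ^ n
    rw [LinearMap.comp_apply, rotP_layerVec]
  rw [tsum_congr h]
  exact (Equiv.prodCongr (Equiv.neg ℤ) (Equiv.neg ℤ)).tsum_eq (layerTerm B n k (-o))

/-- **`Mz` flips the layer**: `layerSum (B ∘ Mz) n k o = layerSum B n (−k) o`. [this file] -/
theorem layerSum_comp_reflZ (B : E3 →ₗ[ℝ] E3) (n : ℕ) (k o : ℤ) : layerSum (B ∘ₗ reflZ) n k o = layerSum B n (-k) o := by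
  unfold layerSum layerTerm
  simp only [LinearMap.comp_apply, reflZ_layerVec]

/-- **`My` flips the label**: `layerSum (B ∘ My) n k o = layerSum B n k (−o)`. [this file] -/
theorem layerSum_comp_reflY (B : E3 →ₗ[ℝ] E3) (n : ℕ) (k o : ℤ) : layerSum (B ∘ₗ reflY) n k o = layerSum B n k (-o) := by
  unfold layerSum
  have h : ∀ ij : ℤ × ℤ, layerTerm (B ∘ₗ reflY) n k o ij = layerTerm B n k (-o) (reflIdx o ij) := fun ij => by
    show (‖(B ∘ₗ reflY) (layerVec ij.1 ij.2 o k)‖)⁻¹ ^ n = (‖B (layerVec (ij.1 + ij.2 + o) (-ij.2) (-o) k)‖)⁻¹ ^ n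
    rw [LinearMap.comp_apply, reflY_layerVec]
  rw [tsum_congr h]
  exact (reflIdx o).tsum_eq (layerTerm B n k (-o))

/-! ## §S4 Axial shapes: the layer sums are even in the label and in the layer index -/

/-- The diagonal shape `diag(a, a, c)` (the symmetric hcp family; `X°` of memo §8 (I)). -/
noncomputable def diag3 (a c : ℝ) : E3 →ₗ[ℝ] E3 where
  toFun v := !₂[a * v 0, a * v 1, c * v 2]
  map_add' v w := by
    ext l; fin_cases l <;> simp <;> ring
  map_smul' r v := by
    ext l; fin_cases l <;> simp <;> ring

/-- `diag3_apply_zero` (docstring added by the landing lane; see the module docstring). [formal bookkeeping] -/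
@[simp] theorem diag3_apply_zero (a c : ℝ) (v : E3) : diag3 a c v 0 = a * v 0 := rfl
/-- `diag3_apply_one` (docstring added by the landing lane; see the module docstring). [formal bookkeeping] -/
@[simp] theorem diag3_apply_one (a c : ℝ) (v : E3) : diag3 a c v 1 = a * v 1 := rfl
/-- `diag3_apply_two` (docstring added by the landing lane; see the module docstring). [formal bookkeeping] -/
@[simp] theorem diag3_apply_two (a c : ℝ) (v : E3) : diag3 a c v 2 = c * v 2 := rfl

/-- `diag3_comp_rotR` (docstring added by the landing lane; see the module docstring). [formal bookkeeping] -/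
theorem diag3_comp_rotR (a c : ℝ) : diag3 a c ∘ₗ rotR = rotR ∘ₗ diag3 a c := by
  apply LinearMap.ext; intro v; ext l
  fin_cases l
  · show diag3 a c (rotR v) 0 = rotR (diag3 a c v) 0
    simp only [diag3_apply_zero, rotR_apply_zero, diag3_apply_one]; ring
  · show diag3 a c (rotR v) 1 = rotR (diag3 a c v) 1
    simp only [diag3_apply_one, rotR_apply_one, diag3_apply_zero]; ring
  · rfl

/-- `diag3_comp_rotP` (docstring added by the landing lane; see the module docstring). [formal bookkeeping] -/
theorem diag3_comp_rotP (a c : ℝ) : diag3 a c ∘ₗ halfTurnLinear = halfTurnLinear ∘ₗ diag3 a c := by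
  apply LinearMap.ext; intro v; ext l
  fin_cases l
  · show diag3 a c (halfTurnLinear v) 0 = halfTurnLinear (diag3 a c v) 0
    simp only [diag3_apply_zero, halfTurnLinear_apply_zero]; ring
  · show diag3 a c (halfTurnLinear v) 1 = halfTurnLinear (diag3 a c v) 1
    simp only [diag3_apply_one, halfTurnLinear_apply_one]; ring
  · rfl

/-- `diag3_comp_reflZ` (docstring added by the landing lane; see the module docstring). [formal bookkeeping] -/
theorem diag3_comp_reflZ (a c : ℝ) : diag3 a c ∘ₗ reflZ = reflZ ∘ₗ diag3 a c := by
  apply LinearMap.ext; intro v; ext l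
  fin_cases l
  · rfl
  · rfl
  · show diag3 a c (reflZ v) 2 = reflZ (diag3 a c v) 2
    simp only [diag3_apply_two, reflZ_apply_two]; ring

/-- **Label parity**: a shape commuting with `P` has `layerSum X n k (−o) = layerSum X n k o`. [this file] -/
theorem layerSum_neg_label {X : E3 →ₗ[ℝ] E3} (hX : X ∘ₗ halfTurnLinear = halfTurnLinear ∘ₗ X) (n : ℕ) (k o : ℤ) :
    layerSum X n k (-o) = layerSum X n k o := by
  rw [← layerSum_comp_rotP X n k o, hX, layerSum_isometry_comp norm_halfTurnLinear]

/-- **Layer parity**: a shape commuting with `Mz` has `layerSum X n (−k) o = layerSum X n k o`. [this file] -/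
theorem layerSum_neg_layer {X : E3 →ₗ[ℝ] E3} (hX : X ∘ₗ reflZ = reflZ ∘ₗ X) (n : ℕ) (k o : ℤ) :
    layerSum X n (-k) o = layerSum X n k o := by
  rw [← layerSum_comp_reflZ X n k o, hX, layerSum_isometry_comp norm_reflZ]

/-- For `X° = diag(a, a, c)`: `layerSum X° n k o` is EVEN in the label `o` (and, by `layerSum_diag3_neg_layer`, even in the layer `k`). [this file] -/
theorem layerSum_diag3_neg_label (a c : ℝ) (n : ℕ) (k o : ℤ) : layerSum (diag3 a c) n k (-o) = layerSum (diag3 a c) n k o :=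
  layerSum_neg_label (diag3_comp_rotP a c) n k o

/-- `layerSum_diag3_neg_layer` (docstring added by the landing lane; see the module docstring). [formal bookkeeping] -/
theorem layerSum_diag3_neg_layer (a c : ℝ) (n : ℕ) (k o : ℤ) : layerSum (diag3 a c) n (-k) o = layerSum (diag3 a c) n k o :=
  layerSum_neg_layer (diag3_comp_reflZ a c) n k o


end Summit.AtomisticToContinuum.Crystallization.Theorems.OverbindingBudgetAffineFarSmoothSplit
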